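import Literature.Topology.FourManifolds.FlipContextExists
import Literature.Topology.FourManifolds.FeetOnLeftHandDisc
import Literature.Topology.FourManifolds.OneHandleOnTop
import Literature.Topology.FourManifolds.HCobordismLevelConnectivityProofs
import Literature.Topology.FourManifolds.SublevelLevelConnected
import Literature.Topology.FourManifolds.SPC4HandlesCancelStep
import HarnessLib

/-!
# The flip context of a `1`-handle of a `1`-handlebody, compatible with its left-hand disc

Topic `Literature/Topology/FourManifolds` (fact seat
`provefact-Literature.Topology.FourManifolds.lauden-f709dd520c`, Laudenbach–Poénaru's Lemma 2: for
every `1`-handle of the handlebody the slide `H₃` and the flip `H₂` of that handle are performed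
with its own Morse function, for which the handle is the top one).  Everything here is
**proved**; no named facts.

Data: a nice Morse function `g` on the cobordism `(W; ∅, ∂W)` of a compact manifold with
boundary, all critical points of index `≤ 1`, exactly one of index `0` and none of index `≥ 2`;
a smooth gradient-like field `ξ`; a critical point `q` of index `1`; a level
`t₁ ∈ (niceLevel n 0, niceLevel n 1)`; an orientation.  Output
(`Cobordism.IsNiceMorseFunction.exists_flipContext_compat`): a left-sphere setting `L` of `q`
for `(g, ξ)` with lower level `t₁`, and a flip context `C` (`FlipContext.lean`) whose function
`f₁` is Milnor's rearrangement of `g` with `q` on top (`exists_oneHandle_on_top_above`: same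
critical points and indices, `ξ` gradient-like, `f₁ = g` off `g⁻¹(t₁, plusLevel n 1)`,
`f₁ = g + d` near `q`), whose chart is the box chart of `L` restricted to where `f₁ = g + d`,
**compatible** with `L` (`Cobordism.LeftSphereSetting.Compat`), together with the facts used by
the realisation theorems (`SlideRealisation.lean`, `FlipRealisation.lean`): the chart has the
box coordinates, `ξ(f₁) ≥ 0` and `> 0` off the critical points of `g`, the critical-point
counts of `f₁`, and **the ball `{g ≤ t₁}` and the stable sets of the other critical points lie
below the seed collar** `{f₁ ≤ c - 5τ}`.

## References

* J. Milnor, *Lectures on the h-cobordism theorem* (1965), Def. 3.9, Thms. 3.13, 4.1, 4.2.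
  [MilnorHCobordism1965]
* F. Laudenbach, V. Poénaru, Bull. Soc. Math. France 100 (1972), proof of Lemma 2 (pp. 339–340).
  [LaudenbachPoenaruBSMF1972]
-/

open scoped Manifold ContDiff Topology
open Set Function Filter Metric

noncomputable section

namespace Literature.Topology.FourManifolds

open BoundaryManifold

universe u

variable {n : ℕ} {W : Type u} [TopologicalSpace W] [T2Space W] [SecondCountableTopology W]
  [CompactSpace W] [ChartedSpace (EuclideanHalfSpace (n + 1)) W] [IsManifold (𝓡∂ (n + 1)) ∞ W]

set_option maxHeartbeats 1600000 in
/-- **The flip context of a `1`-handle, compatible with its left-hand disc** (see the module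
docstring). [cite: MilnorHCobordism1965, Def. 3.9, Thms. 3.13, 4.1, 4.2] [cite: LaudenbachPoenaruBSMF1972, §2, proof of Lemma 2 (pp. 339–340)] -/
theorem Cobordism.IsNiceMorseFunction.exists_flipContext_compat (hn : 2 ≤ n)
    {g : (Cobordism.ofBoundary n W).W → ℝ} (hg : (Cobordism.ofBoundary n W).IsNiceMorseFunction g)
    (ξ : Cₛ^∞⟮𝓡∂ (n + 1); EuclideanSpace ℝ (Fin (n + 1)), (TangentSpace (𝓡∂ (n + 1)) : (Cobordism.ofBoundary n W).W → Type)⟯)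
    (hξ : IsGradientLike (𝓡∂ (n + 1)) g ξ)
    (hidx : ∀ z ∈ criticalSet (𝓡∂ (n + 1)) g, morseIndex (𝓡∂ (n + 1)) g z ≤ 1)
    (h0 : (criticalSetOfIndex (𝓡∂ (n + 1)) g 0).ncard = 1)
    (h2 : ∀ k, 2 ≤ k → (criticalSetOfIndex (𝓡∂ (n + 1)) g k).ncard = 0)
    {q : (Cobordism.ofBoundary n W).W} (hq : q ∈ criticalSetOfIndex (𝓡∂ (n + 1)) g 1)
    {t₁ : ℝ} (ht₀ : Cobordism.niceLevel n 0 < t₁) (ht₁ : t₁ < Cobordism.niceLevel n 1)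
    (oM : SmoothOrientation (𝓡∂ (n + 1)) (Cobordism.ofBoundary n W).W) :
    ∃ (L : Cobordism.LeftSphereSetting (Cobordism.ofBoundary n W) g ξ 0) (C : FlipContext n (Cobordism.ofBoundary n W).W),
      L.q = q ∧ L.b = t₁ ∧ Cobordism.LeftSphereSetting.Compat L C.toSlideContext ∧
      (∀ x, C.φ.extend (𝓡∂ (n + 1)) x = L.box.chart.extend (𝓡∂ (n + 1)) x) ∧
      (∀ u, (C.φ.extend (𝓡∂ (n + 1))).symm u = (L.box.chart.extend (𝓡∂ (n + 1))).symm u) ∧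
      (∀ z, 0 ≤ mlineDeriv (𝓡∂ (n + 1)) C.S.f z (ξ z)) ∧
      (∀ z, ¬ IsMCriticalPt (𝓡∂ (n + 1)) g z → 0 < mlineDeriv (𝓡∂ (n + 1)) C.S.f z (ξ z)) ∧
      (criticalSetOfIndex (𝓡∂ (n + 1)) C.S.f 0).ncard = 1 ∧
      (∀ k, 2 ≤ k → (criticalSetOfIndex (𝓡∂ (n + 1)) C.S.f k).ncard = 0) ∧
      (∀ z ∈ criticalSetOfIndex (𝓡∂ (n + 1)) C.S.f 0, C.S.f z < C.c) ∧
      (∀ x, g x ≤ t₁ → C.S.f x ≤ C.c - 5 * C.τ) ∧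
      (∀ q' ∈ criticalSet (𝓡∂ (n + 1)) g, q' ≠ q → ∀ x ∈ stableSet (𝓡∂ (n + 1)) ξ q', C.S.f x ≤ C.c - 5 * C.τ) := by
  haveI : CompactSpace ((𝓡∂ (n + 1)).boundary W) := compactSpace_boundary n W
  have hn1 : 1 ≤ n := by omega
  -- levels of the nice function
  have hqc : q ∈ criticalSet (𝓡∂ (n + 1)) g := mem_criticalSet.2 hq.1
  have hval : ∀ z ∈ criticalSet (𝓡∂ (n + 1)) g, g z = Cobordism.niceLevel n (morseIndex (𝓡∂ (n + 1)) g z) :=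
    fun z hz => hg.2 z (mem_criticalSet.1 hz)
  have hqval : g q = Cobordism.niceLevel n 1 := by rw [hval q hqc, hq.2]
  have hL0 : 0 < Cobordism.niceLevel n 0 := Cobordism.niceLevel_pos n 0
  have hgM : (Cobordism.ofBoundary n W).IsMorseFunction g := hg.1
  have hgd : MDifferentiable (𝓡∂ (n + 1)) 𝓘(ℝ, ℝ) g := hgM.isMorse.contMDiff.mdifferentiable (by simp)
  /- 1. `q` on top -/
  obtain ⟨f₁, c₀, hf₁, hξ₁, hcrit₁, hidx₁, hc₀t₁, hc₀q, hq1, hothers, hout, -, d, hd⟩ :=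
    hg.exists_oneHandle_on_top_above hn1 ht₀ ht₁ ξ hξ hidx hq
  have hF₁ : IsMorseAdapted (𝓡∂ (n + 1)) f₁ := hf₁.isMorseAdapted_ofBoundary
  have hf₁d : MDifferentiable (𝓡∂ (n + 1)) 𝓘(ℝ, ℝ) f₁ := hf₁.isMorse.contMDiff.mdifferentiable (by simp)
  have hqc₁ : q ∈ criticalSet (𝓡∂ (n + 1)) f₁ := by rw [hcrit₁]; exact hqc
  have hq₁ : IsMCriticalPt (𝓡∂ (n + 1)) f₁ q := mem_criticalSet.1 hqc₁
  /- 2. the left-sphere setting of `q` for `(g, ξ)` down to `t₁` -/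
  obtain ⟨L, hLq, hLb⟩ := hgM.exists_leftSphereSetting ξ hξ hqc (k := 0) (by rw [hq.2]) (hL0.trans ht₀)
    (by rw [hqval]; exact ht₁) (fun z hz h => by
      rcases eq_or_ne (morseIndex (𝓡∂ (n + 1)) g z) 1 with h1 | h1
      · rw [hval z hz, h1, hqval] at h; exact h.2.false.elim
      · have h0' : morseIndex (𝓡∂ (n + 1)) g z = 0 := by have := hidx z hz; omega
        rw [hval z hz, h0'] at h; linarith [h.1])
  subst hLq
  /- 3. the open set where `f₁ = g + d`, and the restricted box chart -/
  obtain ⟨U, hUd, hUo, hqU⟩ : ∃ U : Set (Cobordism.ofBoundary n W).W, (∀ z ∈ U, f₁ z = g z + d) ∧ IsOpen U ∧ L.q ∈ U := by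
    obtain ⟨U, hU, hUo, hqU⟩ := eventually_nhds_iff.1 hd
    exact ⟨U, hU, hUo, hqU⟩
  set box := L.box with hbox
  set φ : OpenPartialHomeomorph (Cobordism.ofBoundary n W).W (EuclideanHalfSpace (n + 1)) := box.chart.restr U with hφdef
  have hφcoe : ∀ x, φ.extend (𝓡∂ (n + 1)) x = box.chart.extend (𝓡∂ (n + 1)) x := fun x => rfl
  have hφsymm : ∀ u, (φ.extend (𝓡∂ (n + 1))).symm u = (box.chart.extend (𝓡∂ (n + 1))).symm u := fun u => rfl
  have hφsrc : φ.source = box.chart.source ∩ U := by rw [hφdef, box.chart.restr_source' U hUo]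
  have hφatlas : φ ∈ IsManifold.maximalAtlas (𝓡∂ (n + 1)) ∞ (Cobordism.ofBoundary n W).W := restr_mem_maximalAtlas _ box.mem_maximalAtlas hUo
  have hqφ : L.q ∈ φ.source := by rw [hφsrc]; exact ⟨box.mem_source, hqU⟩
  -- Milnor form of `f₁` on `φ.source`
  have hfq : ∀ x ∈ φ.source, f₁ x = f₁ L.q + milnorQuadratic 1 (φ.extend (𝓡∂ (n + 1)) x - φ.extend (𝓡∂ (n + 1)) L.q) := by
    intro x hx
    rw [hφsrc] at hx
    rw [hUd x hx.2, hUd L.q hqU, hφcoe, hφcoe]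
    have h := box.apply_eq x hx.1
    rw [L.box_k, Nat.zero_add] at h
    rw [h]; ring
  /- 4. the radius `R₀` of a chart ball mapped into `U` -/
  obtain ⟨R₀, hR₀, hR₀ε, hballU⟩ : ∃ R₀ : ℝ, 0 < R₀ ∧ R₀ ≤ 3 * L.ε ∧
      ∀ u ∈ closedBall (box.chart.extend (𝓡∂ (n + 1)) L.q) R₀, (box.chart.extend (𝓡∂ (n + 1))).symm u ∈ U := by
    have hcont : ContinuousOn (box.chart.extend (𝓡∂ (n + 1))).symm (box.chart.extend (𝓡∂ (n + 1))).target :=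
      box.chart.continuousOn_extend_symm
    have hqt : box.chart.extend (𝓡∂ (n + 1)) L.q ∈ (box.chart.extend (𝓡∂ (n + 1))).target :=
      box.closedBall_subset (mem_closedBall_self (by linarith [box.eps_pos]))
    have hsymmq : (box.chart.extend (𝓡∂ (n + 1))).symm (box.chart.extend (𝓡∂ (n + 1)) L.q) = L.q :=
      (box.chart.extend (𝓡∂ (n + 1))).left_inv (by rw [box.chart.extend_source]; exact box.mem_source)
    have hUn : U ∈ 𝓝 ((box.chart.extend (𝓡∂ (n + 1))).symm (box.chart.extend (𝓡∂ (n + 1)) L.q)) := by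
      rw [hsymmq]; exact hUo.mem_nhds hqU
    have h := hcont _ hqt
    rw [ContinuousWithinAt] at h
    have h' := h hUn
    rw [Filter.mem_map, mem_nhdsWithin] at h'
    obtain ⟨V, hVo, hqV, hV⟩ := h'
    obtain ⟨r, hr, hrV⟩ := Metric.isOpen_iff.1 hVo _ hqV
    refine ⟨min (r / 2) (3 * L.ε), lt_min (by linarith) (by linarith [L.box.eps_pos]), min_le_right _ _, fun u hu => ?_⟩
    have hur : u ∈ V := hrV (closedBall_subset_ball (lt_of_le_of_lt (min_le_left _ _) (by linarith)) hu)
    have hut : u ∈ (box.chart.extend (𝓡∂ (n + 1))).target :=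
      box.closedBall_subset (closedBall_subset_closedBall (min_le_right _ _) hu)
    exact hV ⟨hur, hut⟩
  have hR : closedBall (φ.extend (𝓡∂ (n + 1)) L.q) R₀ ⊆ (φ.extend (𝓡∂ (n + 1))).target := by
    intro u hu
    rw [hφcoe] at hu
    have hut : u ∈ (box.chart.extend (𝓡∂ (n + 1))).target :=
      box.closedBall_subset (closedBall_subset_closedBall hR₀ε hu)
    rw [OpenPartialHomeomorph.extend_target] at hut ⊢
    refine ⟨?_, hut.2⟩
    rw [mem_preimage, hφdef, box.chart.restr_toPartialEquiv, PartialEquiv.restr_target, hUo.interior_eq]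
    refine ⟨hut.1, ?_⟩
    show box.chart.symm ((𝓡∂ (n + 1)).symm u) ∈ U
    exact hballU u hu
  /- 5. the levels: `c₀ < f₁ q`, the other critical points below `c₀`, connected levels -/
  have hcrit : ∀ x, IsMCriticalPt (𝓡∂ (n + 1)) f₁ x → x ≠ L.q → f₁ x < c₀ := fun x hx hxq =>
    hothers x (by rw [← hcrit₁]; exact mem_criticalSet.2 hx) hxq
  have hSg : ∀ k, criticalSetOfIndex (𝓡∂ (n + 1)) f₁ k = criticalSetOfIndex (𝓡∂ (n + 1)) g k :=
    fun k => criticalSetOfIndex_congr hcrit₁ hidx₁ k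
  have h0₁ : (criticalSetOfIndex (𝓡∂ (n + 1)) f₁ 0).ncard = 1 := by rw [hSg]; exact h0
  have h2₁ : ∀ k, 2 ≤ k → (criticalSetOfIndex (𝓡∂ (n + 1)) f₁ k).ncard = 0 := fun k hk => by rw [hSg]; exact h2 k hk
  have hmin₁ : ∀ z ∈ criticalSetOfIndex (𝓡∂ (n + 1)) f₁ 0, f₁ z < c₀ := by
    intro z hz
    rw [hSg] at hz
    refine hothers z hz.1 fun h => ?_
    rw [h] at hz; exact zero_ne_one (hz.2.symm.trans hq.2)
  have hconn : ∀ c, c₀ < c → c < f₁ L.q → IsConnected (f₁ ⁻¹' {c}) := by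
    intro c hc₀ hcq
    have hc1 : c < 1 := hcq.trans (hF₁.2.2 L.q (hF₁.isInteriorPoint_of_isMCriticalPt hq₁))
    refine hF₁.isConnected_level_of_counts hn hc1 (fun z hz h => ?_) h0₁ h2₁ (fun z hz => (hmin₁ z hz).trans hc₀)
    by_cases hzq : z = L.q
    · rw [hzq] at h; linarith
    · have := hcrit z hz hzq; linarith
  /- 6. the flip context -/
  obtain ⟨C, hCf, hCp, hCφ, hCR, hCε, hCc, hDe, hDs, hDs', hDe'⟩ :=
    exists_flipContext hn hF₁ hq₁ hφatlas hqφ hfq hR₀ hR hc₀q hcrit hconn oM L.box.eps_pos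
  refine ⟨L, C, rfl, hLb, ?_, fun x => by rw [hCφ]; rfl, fun u => by rw [hCφ]; rfl, ?_, ?_, ?_, ?_, ?_, ?_, ?_⟩
  · -- compatibility with the left-sphere setting
    refine ⟨hCp, fun x hx => by rw [hDe x]; rfl, ?_, fun w hw => ?_, by nlinarith [hCε, C.S.ε_pos, L.box.eps_pos], ⟨d, fun x hx => ?_⟩⟩
    · rw [hDs, hφsrc]; exact fun x hx => hx.1.1
    · -- chart points of norm `≤ ε` lie in the handle chart
      rw [hDs, hφsrc]
      have hwt : box.chart.extend (𝓡∂ (n + 1)) L.q + w ∈ closedBall (box.chart.extend (𝓡∂ (n + 1)) L.q) R₀ := by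
        rw [mem_closedBall, dist_eq_norm, add_sub_cancel_left]; linarith [C.hεR]
      have hwt' : box.chart.extend (𝓡∂ (n + 1)) L.q + w ∈ (box.chart.extend (𝓡∂ (n + 1))).target :=
        box.closedBall_subset (by rw [mem_closedBall, dist_eq_norm, add_sub_cancel_left]; linarith [C.hεR])
      have hsrc : L.chartPoint w ∈ box.chart.source := by
        have := (box.chart.extend (𝓡∂ (n + 1))).map_target hwt'
        rwa [box.chart.extend_source] at this
      refine ⟨⟨hsrc, hballU _ hwt⟩, ?_⟩
      rw [mem_preimage, mem_ball, dist_eq_norm]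
      show ‖box.chart.extend (𝓡∂ (n + 1)) (L.chartPoint w) - box.chart.extend (𝓡∂ (n + 1)) L.q‖ < 4 * C.S.ε
      rw [show box.chart.extend (𝓡∂ (n + 1)) (L.chartPoint w) = box.chart.extend (𝓡∂ (n + 1)) L.q + w from
        (box.chart.extend (𝓡∂ (n + 1))).right_inv hwt', add_sub_cancel_left]
      linarith [C.S.ε_pos]
    · -- `f₁ = g + d` on the handle chart
      rw [hCf]
      have hx' : x ∈ φ.source := by rw [hDs] at hx; exact hx.1
      rw [hφsrc] at hx'
      exact hUd x hx'.2
  · -- `ξ(f₁) ≥ 0`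
    intro z
    by_cases hz : IsMCriticalPt (𝓡∂ (n + 1)) C.S.f z
    · rw [hz.mlineDeriv_eq_zero]
    · rw [hCf] at hz ⊢; exact (hξ₁.mlineDeriv_pos z hz).le
  · -- `ξ(f₁) > 0` off the critical points of `g`
    intro z hz
    rw [hCf]
    refine hξ₁.mlineDeriv_pos z fun hz₁ => hz ?_
    exact mem_criticalSet.1 (hcrit₁ ▸ mem_criticalSet.2 hz₁)
  · rw [hCf]; exact h0₁
  · rw [hCf]; exact h2₁
  · rw [hCf]; exact fun z hz => (hmin₁ z hz).trans (by linarith [C.τ_pos])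
  · -- the ball `{g ≤ t₁}` lies below the seed collar
    intro x hx
    rw [hCf, hout x (fun h => by linarith [h.1])]
    linarith
  · -- the stable sets of the other critical points lie below the seed collar
    intro q' hq' hq'q x hx
    rw [hCf]
    have h1 : f₁ x ≤ f₁ q' := hξ₁.apply_le_of_mem_stableSet hf₁d hx
    have h2 : f₁ q' < c₀ := hothers q' hq' hq'q
    linarith

end Literature.Topology.FourManifolds
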